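import Summits.AtomisticToContinuum.BoseEinsteinCondensation.Theorems.BECDyadicChainingBaseCoherentMassCompositionAux
import Summits.AtomisticToContinuum.BoseEinsteinCondensation.Theorems.BECDyadicChainingBaseCoherentMassBlockMassCapture
import Summits.AtomisticToContinuum.BoseEinsteinCondensation.Theorems.BECDyadicChainingBaseCoherentMassOccupationLeDensity
import Summits.AtomisticToContinuum.BoseEinsteinCondensation.Theorems.BECDyadicChainingBaseCoherentMassCellLedger
import Summits.AtomisticToContinuum.BoseEinsteinCondensation.Theorems.BECDyadicChainingBaseCoherentMassNoClumpingInteracting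
import Summits.AtomisticToContinuum.BoseEinsteinCondensation.Theorems.BECDyadicChainingBaseCoherentMassSineGap
import Summits.AtomisticToContinuum.BoseEinsteinCondensation.Theorems.BECDyadicChainingBaseCoherentMassFreeUpperBound
import Summits.AtomisticToContinuum.BoseEinsteinCondensation.Theorems.BECDyadicChainingBaseCoherentMassFreeBase
import Literature.MathematicalPhysics.QuantumManyBody.PeriodicBoseGasScattering

/-!
# Route `BECDyadicChaining` — crux `BaseCoherentMass` (stmt-AtomisticToContinuum-13193): the closing file

Closes stmt-AtomisticToContinuum-13193, the exact signature of
`Summit.AtomisticToContinuum.BoseEinsteinCondensation.Theses.BECDyadicChaining.BaseCoherentMass`: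
for every repulsive finite-range `v` and every `ℓ_d > 0`, at small density there is a base scale
`ℓ_b ≥ ℓ_d` such that, eventually in `N`, the dyadic level `K` with cube side `L/2^K ∈ [ℓ_b, 2ℓ_b)`
(`L = (N/ρ)^{1/3}`) carries coherent amplitude `A_K = 8^{-K/2} Σ_B √n_B ≥ √N/2` on every
near-minimiser (`n_B = ⟨φ_B, γ_Ψ φ_B⟩` for the flat modes `φ_B` of the open dyadic cubes `B`).

Proof = the composition of the line `registered` (birth skeleton, reshaped by the lead) over its seven
landed stubs and the composition helpers (all in
`Summit.AtomisticToContinuum.BoseEinsteinCondensation.Theorems.BaseCoherentMass`):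
* interacting case `a(v) > 0`: base scale `ℓ_b = (M/ρ)^{1/3}` (`M` from `stub_noClumpingInteracting`),
  level `K` with `L/2^K ∈ [ℓ_b, 2ℓ_b)` so that `M 8^K ≤ N < 8M 8^K`, `δ = min δ_Q 1`; block-mass
  capture `N ≤ Σ_B n_B + (s²/π²)∫|∇Ψ|²` (`stub_blockMassCapture`) with the kinetic budget
  `E₀ ≤ ε ρ^{2/3} N` (`kineticBudget`, `ε = π²/(1600 M^{2/3})`) gives `Σ_B n_B ≥ (199/200) N`;
  occupations are dominated by expected cell numbers (`stub_occupationLeDensity`), which split as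
  `m + o` with `Σ m² ≤ (15/4)N²/8^K`, `Σ o ≤ N/200` (`stub_noClumpingInteracting`, whose bookkeeping is
  `stub_cellLedger`); the truncated tangent-line Hölder step (`sqrt_le_two_coherentAmplitude_of_ledger`)
  yields `√N ≤ 2 A_K`.
* free case `a(v) = 0`: `v(|x|) = 0` a.e. (`LSSY2005_zeroScatteringLength_holds`), all energies are
  the free ones (`energy_eq_energy_zero`), `ℓ_b = ℓ_d`, and `stub_freeBase` (complete condensation of
  free Dirichlet near-minimisers into the sine mode, from `stub_sineGap` and `stub_freeUpperBound`)
  gives `√N ≤ 2 A_K` at every level.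

References: [LSSY2005] §1.2 (1.17), (2.44)–(2.56), Thm. 2.2, Ch. 5 (5.15)–(5.17), App. C;
[LiebYngvason1998]; [Dyson1957].
-/

noncomputable section

namespace Summit.AtomisticToContinuum.BoseEinsteinCondensation.Theorems

open scoped BigOperators ENNReal ComplexConjugate
open Filter MeasureTheory
open Literature.MathematicalPhysics.QuantumManyBody.BoseGas
open BaseCoherentMass

/-- **Item `BaseCoherentMass` of route `BECDyadicChaining` (stmt-AtomisticToContinuum-13193): coherent
mass at a base scale.** For every repulsive finite-range `v` and every `ℓ_d > 0` there is `ρ₀ > 0`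
such that for `0 < ρ < ρ₀` there is `ℓ_b ≥ ℓ_d` with: for all large `N` there are a level `K` with
`L/2^K ∈ [ℓ_b, 2ℓ_b)` and `δ > 0` such that every `δ`-near-minimiser of the Dirichlet energy in the
box of side `L = (N/ρ)^{1/3}` has `√N ≤ 2 · 8^{-K/2} Σ_B √⟨φ_B, γ_Ψ φ_B⟩`. Free case by condensation
into the sine mode; interacting case by block-mass capture + truncated no-clumping + tangent-line
Hölder on the interparticle scale. [cite: LSSY2005, Ch. 5 (5.15)–(5.17), (2.52)–(2.54), Thm. 2.2] -/
theorem baseCoherentMass_proof :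
    Summit.AtomisticToContinuum.BoseEinsteinCondensation.Theses.BECDyadicChaining.BaseCoherentMass := by
  intro v hv ℓd hℓd
  classical
  obtain ⟨hvm, R₀, hR₀⟩ := id hv
  rcases eq_or_ne (scatteringLength v) 0 with ha0 | ha0
  · /- the free case `a = 0` -/
    have hv0 : ∀ᵐ x : Space, v ‖x‖ = 0 := LSSY2005_zeroScatteringLength_holds v R₀ hvm hR₀ ha0
    refine ⟨1, one_pos, fun ρ hρ _ => ⟨ℓd, le_rfl, ?_⟩⟩
    filter_upwards [(tendsto_sideLength_atTop hρ).eventually_ge_atTop ℓd, Filter.eventually_gt_atTop 0]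
      with N hNL hN0
    obtain ⟨K, hK1, hK2⟩ := exists_level hℓd hNL
    have hL : 0 < sideLength ρ N := hℓd.trans_le hNL
    obtain ⟨δ, hδ, HΨ⟩ := stub_freeBase stub_sineGap stub_freeUpperBound N (sideLength ρ N) hL hN0
    refine ⟨K, hK1, hK2, δ, hδ, fun Ψ hΨ => ?_⟩
    have hΨ0 : energy 0 Ψ ≤ groundStateEnergy 0 N (sideLength ρ N) + δ := by
      rw [← energy_eq_energy_zero hvm hv0 Ψ, ← groundStateEnergy_eq_zero_pot hvm hv0]
      exact hΨ
    have h := HΨ Ψ hΨ0 K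
    simp only [occupation_openMode_eq]
    exact h
  · /- the interacting case `a > 0` -/
    have ha : 0 < scatteringLength v := pos_iff_ne_zero.mpr ha0
    -- (1) data of the no-clumping stub; the Poincaré budget `ε`; the kinetic budget at this `ε`
    obtain ⟨M, hM, ρQ, hρQ, HQ⟩ := stub_noClumpingInteracting stub_cellLedger v hv ha
    have hM23 : 0 < M ^ (2 / 3 : ℝ) := Real.rpow_pos_of_pos hM _
    set ε : ℝ := Real.pi ^ 2 / (1600 * M ^ (2 / 3 : ℝ)) with hε
    have hεpos : 0 < ε := by positivity
    obtain ⟨ρE, hρE, HE⟩ := kineticBudget hv ha hεpos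
    have hℓd3 : 0 < ℓd ^ 3 := by positivity
    refine ⟨min (min ρQ ρE) (M / ℓd ^ 3), lt_min (lt_min hρQ hρE) (div_pos hM hℓd3), ?_⟩
    intro ρ hρ hρlt
    have hρQ' : ρ < ρQ := hρlt.trans_le ((min_le_left _ _).trans (min_le_left _ _))
    have hρE' : ρ < ρE := hρlt.trans_le ((min_le_left _ _).trans (min_le_right _ _))
    have hρℓ : ρ < M / ℓd ^ 3 := hρlt.trans_le (min_le_right _ _)
    have hρ23 : 0 < ρ ^ (2 / 3 : ℝ) := Real.rpow_pos_of_pos hρ _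
    -- (2) the base scale `ℓ_b = (M/ρ)^{1/3}`: cubes of side `≥ ℓ_b` hold `≥ M` particles on average
    have hMρ : 0 < M / ρ := div_pos hM hρ
    set ℓb : ℝ := (M / ρ) ^ (1 / 3 : ℝ) with hℓb
    have hℓbpos : 0 < ℓb := Real.rpow_pos_of_pos hMρ _
    have hℓb3 : ℓb ^ 3 = M / ρ := by
      rw [hℓb, ← Real.rpow_natCast, ← Real.rpow_mul hMρ.le]; norm_num
    have hℓb2 : ℓb ^ 2 * ρ ^ (2 / 3 : ℝ) = M ^ (2 / 3 : ℝ) := by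
      have e1 : ℓb ^ 2 = (M / ρ) ^ (2 / 3 : ℝ) := by
        rw [hℓb, ← Real.rpow_natCast, ← Real.rpow_mul hMρ.le]; norm_num
      rw [e1, ← Real.mul_rpow hMρ.le hρ.le, div_mul_cancel₀ M hρ.ne']
    have hℓdb : ℓd ≤ ℓb := by
      have h1 : ℓd ^ 3 < ℓb ^ 3 := by
        rw [hℓb3, lt_div_iff₀ hρ]
        have h2 := (lt_div_iff₀ hℓd3).mp hρℓ
        linarith [mul_comm ρ (ℓd ^ 3)]
      by_contra hcon
      have h3 : ℓb ^ 3 ≤ ℓd ^ 3 := pow_le_pow_left₀ hℓbpos.le (not_le.mp hcon).le 3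
      linarith
    refine ⟨ℓb, hℓdb, ?_⟩
    -- (3) eventualities in `N`: the two stubs, `L ≥ ℓ_b`, and the `δ ≤ 1` slack is `≤ N/400`
    have EL : ∀ᶠ N : ℕ in Filter.atTop, ℓb ≤ sideLength ρ N :=
      (tendsto_sideLength_atTop hρ).eventually_ge_atTop ℓb
    have E1 : ∀ᶠ N : ℕ in Filter.atTop, 4 * ℓb ^ 2 / Real.pi ^ 2 ≤ (N : ℝ) / 400 := by
      filter_upwards [Filter.eventually_ge_atTop ⌈400 * (4 * ℓb ^ 2 / Real.pi ^ 2)⌉₊] with N hN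
      have h1 : 400 * (4 * ℓb ^ 2 / Real.pi ^ 2) ≤ (N : ℝ) :=
        (Nat.le_ceil _).trans (by exact_mod_cast hN)
      linarith
    filter_upwards [HQ ρ hρ hρQ', HE ρ hρ hρE', EL, E1, Filter.eventually_gt_atTop 0] with N hNQ hNE
      hNL hN1 hN0
    obtain ⟨δQ, hδQ, HΨQ⟩ := hNQ
    have hNpos : (0 : ℝ) < N := Nat.cast_pos.mpr hN0
    have hL3 : sideLength ρ N ^ 3 = N / ρ := by
      have h0 : (0 : ℝ) ≤ N / ρ := div_nonneg (Nat.cast_nonneg N) hρ.le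
      rw [sideLength, ← Real.rpow_natCast, ← Real.rpow_mul h0]; norm_num
    -- (4) the base level `K`: `L/2^K ∈ [ℓ_b, 2ℓ_b)`
    obtain ⟨K, hK1, hK2⟩ := exists_level hℓbpos hNL
    have h8K : (0 : ℝ) < 8 ^ K := pow_pos (by norm_num) K
    set L : ℝ := sideLength ρ N with hLdef
    have hcube : (L / 2 ^ K) ^ 3 = (N : ℝ) / ρ / 8 ^ K := by
      rw [div_pow, hL3, ← pow_mul, mul_comm K 3, pow_mul]; norm_num
    have hMK : M * 8 ^ K ≤ (N : ℝ) := by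
      have h1 : ℓb ^ 3 ≤ (L / 2 ^ K) ^ 3 := pow_le_pow_left₀ hℓbpos.le hK1 3
      rw [hℓb3, hcube, le_div_iff₀ h8K, div_mul_eq_mul_div, div_le_div_iff_of_pos_right hρ] at h1
      exact h1
    have hMK' : (N : ℝ) < 8 * M * 8 ^ K := by
      have h0 : 0 ≤ L / 2 ^ K := hℓbpos.le.trans hK1
      have h1 : (L / 2 ^ K) ^ 3 < (2 * ℓb) ^ 3 := pow_lt_pow_left₀ hK2 h0 (by norm_num)
      rw [hcube, mul_pow, hℓb3, div_lt_iff₀ h8K, div_lt_iff₀ hρ] at h1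
      have : (2 : ℝ) ^ 3 * (M / ρ) * 8 ^ K * ρ = 8 * M * 8 ^ K * (ρ / ρ) := by ring
      rw [this, div_self hρ.ne', mul_one] at h1
      exact h1
    have hsK : (L / 2 ^ K) ^ 2 ≤ 4 * ℓb ^ 2 := by
      have h0 : 0 ≤ L / 2 ^ K := hℓbpos.le.trans hK1
      calc (L / 2 ^ K) ^ 2 ≤ (2 * ℓb) ^ 2 := pow_le_pow_left₀ h0 hK2.le 2
        _ = 4 * ℓb ^ 2 := by ring
    -- (5) the slack `δ = min δ_Q 1` and a near-minimiser `Ψ`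
    refine ⟨K, hK1, hK2, min δQ 1, lt_min hδQ one_pos, fun Ψ hΨ => ?_⟩
    simp only [occupation_openMode_eq]
    set n : (Fin 3 → Fin (2 ^ K)) → ℝ≥0∞ := fun i => occupation N (dyMode L K i) Ψ.ψ with hn
    -- the inputs at level `K`
    obtain ⟨m, o, hmo, hm2, ho⟩ :=
      HΨQ Ψ (hΨ.trans (add_le_add le_rfl (min_le_left _ _))) K hMK hMK'
    have hle : ∀ i, n i ≤ m i + o i := fun i =>
      (stub_occupationLeDensity N L Ψ K i).trans (hmo i)
    have hPK : (N : ℝ≥0∞) ≤ (∑ i, n i) +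
        ENNReal.ofReal ((L / 2 ^ K) ^ 2 / Real.pi ^ 2) * ∫⁻ X, kineticDensity Ψ.ψ X :=
      stub_blockMassCapture N L Ψ K
    have hkin : ∫⁻ X, kineticDensity Ψ.ψ X ≤ ENNReal.ofReal (ε * ρ ^ (2 / 3 : ℝ) * N) + 1 :=
      calc ∫⁻ X, kineticDensity Ψ.ψ X ≤ energy v Ψ := lintegral_mono fun X => le_self_add
        _ ≤ groundStateEnergy v N L + min δQ 1 := hΨ
        _ ≤ ENNReal.ofReal (ε * ρ ^ (2 / 3 : ℝ) * N) + 1 := add_le_add hNE (min_le_right _ _)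
    -- (6) the Poincaré loss is at most `N/200`, so `Σ_B n_B ≥ (199/200) N`
    have hloss : (L / 2 ^ K) ^ 2 / Real.pi ^ 2 * (ε * ρ ^ (2 / 3 : ℝ) * N + 1) ≤ (N : ℝ) / 200 := by
      have hπ : 0 < Real.pi ^ 2 := by positivity
      have hX : 0 ≤ ε * ρ ^ (2 / 3 : ℝ) * N + 1 := by positivity
      have h1 : (L / 2 ^ K) ^ 2 / Real.pi ^ 2 ≤ 4 * ℓb ^ 2 / Real.pi ^ 2 :=
        div_le_div_of_nonneg_right hsK hπ.le
      have h2 : 4 * ℓb ^ 2 / Real.pi ^ 2 * (ε * ρ ^ (2 / 3 : ℝ) * N) = (N : ℝ) / 400 := by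
        rw [hε, ← hℓb2]
        field_simp
        ring
      calc (L / 2 ^ K) ^ 2 / Real.pi ^ 2 * (ε * ρ ^ (2 / 3 : ℝ) * N + 1)
          ≤ 4 * ℓb ^ 2 / Real.pi ^ 2 * (ε * ρ ^ (2 / 3 : ℝ) * N + 1) := mul_le_mul_of_nonneg_right h1 hX
        _ = (N : ℝ) / 400 + 4 * ℓb ^ 2 / Real.pi ^ 2 := by rw [mul_add, mul_one, h2]
        _ ≤ (N : ℝ) / 400 + (N : ℝ) / 400 := add_le_add le_rfl hN1
        _ = (N : ℝ) / 200 := by ring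
    have hS1 : ENNReal.ofReal (199 / 200 * (N : ℝ)) ≤ ∑ i, n i := by
      have hs0 : 0 ≤ (L / 2 ^ K) ^ 2 / Real.pi ^ 2 := by positivity
      have hE0 : 0 ≤ ε * ρ ^ (2 / 3 : ℝ) * N := by positivity
      have h1 : ENNReal.ofReal ((L / 2 ^ K) ^ 2 / Real.pi ^ 2) * ∫⁻ X, kineticDensity Ψ.ψ X ≤
          ENNReal.ofReal ((N : ℝ) / 200) :=
        calc ENNReal.ofReal ((L / 2 ^ K) ^ 2 / Real.pi ^ 2) * ∫⁻ X, kineticDensity Ψ.ψ X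
            ≤ ENNReal.ofReal ((L / 2 ^ K) ^ 2 / Real.pi ^ 2) *
                (ENNReal.ofReal (ε * ρ ^ (2 / 3 : ℝ) * N) + 1) := mul_le_mul' le_rfl hkin
          _ = ENNReal.ofReal ((L / 2 ^ K) ^ 2 / Real.pi ^ 2) *
                ENNReal.ofReal (ε * ρ ^ (2 / 3 : ℝ) * N + 1) := by
              rw [ENNReal.ofReal_add hE0 zero_le_one, ENNReal.ofReal_one]
          _ = ENNReal.ofReal ((L / 2 ^ K) ^ 2 / Real.pi ^ 2 * (ε * ρ ^ (2 / 3 : ℝ) * N + 1)) :=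
              (ENNReal.ofReal_mul hs0).symm
          _ ≤ ENNReal.ofReal ((N : ℝ) / 200) := ENNReal.ofReal_le_ofReal hloss
      have h2 : (N : ℝ≥0∞) = ENNReal.ofReal (199 / 200 * (N : ℝ)) + ENNReal.ofReal ((N : ℝ) / 200) := by
        rw [← ENNReal.ofReal_add (by positivity) (by positivity), ← ENNReal.ofReal_natCast N]
        congr 1
        ring
      have h3 : ENNReal.ofReal (199 / 200 * (N : ℝ)) + ENNReal.ofReal ((N : ℝ) / 200) ≤
          (∑ i, n i) + ENNReal.ofReal ((N : ℝ) / 200) := by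
        rw [← h2]
        exact hPK.trans (add_le_add le_rfl h1)
      exact (ENNReal.add_le_add_iff_right ENNReal.ofReal_ne_top).mp h3
    -- (7) truncated tangent-line Hölder
    exact sqrt_le_two_coherentAmplitude_of_ledger hN0 n m o hle hS1 hm2 ho


end Summit.AtomisticToContinuum.BoseEinsteinCondensation.Theorems

end
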